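import Mathlib
import Summits.KontsevichZagierPeriods.Zeta5Search.SecondDigitSeries
import Summits.KontsevichZagierPeriods.Zeta5Search.GHatSecondOrder
import HarnessLib

/-!
# ζ(5) search — the CLASSWISE SECOND-DIGIT LEMMA for the `W`-row is a THEOREM (gen-2 g10's (W2), `SecondDigitW`)

Cell `pub-zeta5` (HONEST FRAMING: systematic search; no irrationality claim unless certified), typer seat generation 11.
Discharges BY NAME `SecondOrder.SecondDigitW` of `Zeta5Search/SecondOrderDigit.lean` (gen-2 g10, REPORT-gen2-g10 §1, exact check
123,662 pole classes): for a residue class with base `x < p` (window `5 ≤ p`, `b₀ + 2 < p²`),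
**`v_p( W_x − (−p)^{E_x+3} ĝ_x (ŵ_x − p φ_x ŵ₂_x) ) ≥ E_x + 5`**, `W_x = Σ_{s ∈ x} c_{2,s}`.
Proof: Theorem B to second order at `σ = 3` for every pole of order `≥ 3` (`leadingDigit₂`: digit `ĝ_s(ρ_{s,3} − pφ_sρ_{s,4})`),
then the units are moved to the base: `ĝ_s ≡ ĝ_x(1 − ℓ_s p φ_x) (mod p²)` (`padicNorm_gHat_sub_second_le`), `φ_s ≡ φ_x`,
`ĝ_s ≡ ĝ_x (mod p)` (G1), which turns `ρ_{s,3}` into `ρ_{s,3} − pφ_x ℓ_s ρ_{s,3}` — the `ℓρ₃ + ρ₄` of `ŵ₂ = ŵ[ηΦ_x]`.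
`p`-adic valuations of rational numbers; nothing here concerns irrationality.
-/

noncomputable section

open Finset PowerSeries

namespace Summit.KontsevichZagierPeriods.Zeta5Search.SecondOrder

open Summit.KontsevichZagierPeriods.Zeta5Search.DualSeries (InBox)
open Summit.KontsevichZagierPeriods.Zeta5Search.WedgeDictionary (pfData)
open Summit.KontsevichZagierPeriods.Zeta5Search.CasoratianValuation (InPolytope)
open Summit.KontsevichZagierPeriods.Zeta5Search.ClusterValuation
open Summit.KontsevichZagierPeriods.Zeta5Search.PadicSeries
open Summit.KontsevichZagierPeriods.Zeta5Search.CellA (padicNorm_classRho_le_one pfData_eq_zero_of_order_le gHat_classCongr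
  padicNorm_pow_eq padicNorm_mul_sub_mul_le padicNorm_p)

variable {p : ℕ} [hp : Fact p.Prime]

/-- G1 in norm form: `‖ĝ_q‖ ≤ 1` and `‖ĝ_q − ĝ_{q'}‖ ≤ p⁻¹` on a class. -/
theorem padicNorm_gHat_class (b : ℕ → ℤ) (hb : InPolytope b) (hp5 : 5 ≤ p) {x q q' : ℕ} (hx : x < p)
    (hq : q ∈ classSet b p x) (hq' : q' ∈ classSet b p x) :
    padicNorm p (gHat b p q) ≤ 1 ∧ padicNorm p (gHat b p q - gHat b p q') ≤ (p : ℚ) ^ (-(1 : ℤ)) := by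
  have hG := gHat_classCongr b p x q q' hb hp.out hp5 hx hq hq'
  refine ⟨?_, padicNorm_le_of_val fun hne => hG.2 (sub_ne_zero.1 hne)⟩
  by_cases h0 : gHat b p q = 0
  · rw [h0, padicNorm.zero]; exact zero_le_one
  · rw [padicNorm.eq_zpow_of_nonzero h0, hG.1]; simp

omit hp in
/-- The base `x < p` of a class with a pole lies in the class (as a position `≤ b₀`). -/
theorem base_mem_classSet (b : ℕ → ℤ) {x : ℕ} (hx : x < p) (hpole : 1 ≤ classPoleCount b p x) : x ∈ classSet b p x := by
  obtain ⟨q, hq⟩ := card_pos.1 (show 0 < ((classSet b p x).filter fun s => netExp b s < 0).card from hpole)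
  have hq' := (mem_filter.1 hq).1
  obtain ⟨hqr, hqx⟩ := mem_filter.1 hq'
  refine mem_filter.2 ⟨mem_range.2 ?_, rfl⟩
  have : x ≤ q := by rw [Nat.mod_eq_of_lt hx] at hqx; rw [← hqx]; exact Nat.mod_le q p
  exact lt_of_le_of_lt this (mem_range.1 hqr)

/-- **(W2) — the classwise second digit of the `W`-row (gen-2 g10's `SecondDigitW`) is a theorem.** -/
theorem secondDigitW_holds : SecondDigitW := by
  intro b p x hb hprime hp5 hwin hx hpole hne
  haveI : Fact p.Prime := ⟨hprime⟩
  obtain ⟨hbox, -, -, hn⟩ := thmA_data b hb hwin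
  have h0 : 0 ≤ b 0 := hbox.1
  have hp2 : p ≠ 2 := by omega
  have hp0 : (p : ℚ) ≠ 0 := Nat.cast_ne_zero.2 hprime.ne_zero
  have hp' : (-(p : ℚ)) ≠ 0 := neg_ne_zero.2 hp0
  have hxmem : x ∈ classSet b p x := base_mem_classSet b hx hpole
  set E := classExp b p x with hE
  set g := gHat b p x with hg
  set φ := phiHat b p x with hφ
  -- `ŵ` and `ŵ₂` as sums over the whole class
  have hw : wHat b p x = ∑ s ∈ classSet b p x, (if netExp b s ≤ -3 then classRho b p s 3 else 0) := by
    rw [wHat, classPoles, sum_filter]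
    refine sum_congr rfl fun s _ => ?_
    by_cases h3 : netExp b s ≤ -3
    · rw [if_pos (by omega), if_pos h3]
    · rw [if_neg h3]; split_ifs <;> rfl
  have hw2 : wHat2 b p x = ∑ s ∈ classSet b p x,
      ((if netExp b s ≤ -3 then ((s / p : ℕ) : ℚ) * classRho b p s 3 else 0)
        + (if netExp b s ≤ -4 then classRho b p s 4 else 0)) := by
    rw [wHat2, classPoles, sum_filter]
    refine sum_congr rfl fun s _ => ?_
    by_cases h3 : netExp b s ≤ -3
    · rw [if_pos (by omega)]
    · rw [if_neg h3, if_neg (show ¬ netExp b s ≤ -4 by omega)]; split_ifs <;> simp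
  -- the termwise form of the difference
  set T : ℕ → ℚ := fun s => pfData b 2 s - (-(p : ℚ)) ^ (E + 3) * g *
      ((if netExp b s ≤ -3 then classRho b p s 3 else 0)
        - (p : ℚ) * φ * ((if netExp b s ≤ -3 then ((s / p : ℕ) : ℚ) * classRho b p s 3 else 0)
            + (if netExp b s ≤ -4 then classRho b p s 4 else 0))) with hT
  have hsplit : (∑ s ∈ classSet b p x, pfData b 2 s) - (-(p : ℚ)) ^ (E + 3) * g * (wHat b p x - (p : ℚ) * φ * wHat2 b p x) =
      ∑ s ∈ classSet b p x, T s := by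
    rw [hw, hw2, hT, mul_sum, ← sum_sub_distrib, mul_sum, ← sum_sub_distrib]
  -- common norms
  have hpow : padicNorm p ((-(p : ℚ)) ^ (E + 3)) = (p : ℚ) ^ (-(E + 3)) := by
    rw [padicNorm.eq_zpow_of_nonzero (zpow_ne_zero _ hp'), padicValRat.zpow, padicValRat.neg,
      padicValRat.self hprime.one_lt, mul_one]
  have hgx1 : padicNorm p g ≤ 1 := (padicNorm_gHat_class b hb hp5 hx hxmem hxmem).1
  have hφ1 : padicNorm p φ ≤ 1 := padicNorm_phiHat_le_one b hp2 x
  -- termwise bound `p^{-(E+5)}`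
  have hterm : ∀ s ∈ classSet b p x, padicNorm p (T s) ≤ (p : ℚ) ^ (-(E + 5)) := by
    intro s hs
    have hsn : s ≤ (b 0).toNat := ((mem_classSet_iff b x s).1 hs).1
    have hEs : classExp b p s = E := classExp_eq_of_mem hs
    by_cases h3 : netExp b s ≤ -3
    · -- a pole of order ≥ 3: second-order Theorem B, then move the units to the base
      have hTs : T s = pfData b 2 s - (-(p : ℚ)) ^ (E + 3) * g * (classRho b p s 3 - (p : ℚ) * φ *
          (((s / p : ℕ) : ℚ) * classRho b p s 3 + (if netExp b s ≤ -4 then classRho b p s 4 else 0))) := by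
        simp only [hT, if_pos h3]
      set ρ3 := classRho b p s 3 with hρ3
      set ρ4 : ℚ := if netExp b s ≤ -4 then classRho b p s 4 else 0 with hρ4
      set gs := gHat b p s with hgs
      set φs := phiHat b p s with hφs
      set ℓ : ℚ := ((s / p : ℕ) : ℚ) with hℓ
      -- Theorem B to second order at σ = 3
      have hB : padicNorm p (pfData b 2 s - (-(p : ℚ)) ^ (E + 3) * gs * (ρ3 - (p : ℚ) * φs * ρ4)) ≤
          (p : ℚ) ^ (-(E + 5)) := by
        have h := leadingDigit₂ b hb hp5 hwin hsn (σ := 3) (by norm_num) (by push_cast; omega)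
        have e4 : (if ((3 : ℕ) : ℤ) + 1 ≤ -netExp b s then classRho b p s (3 + 1) else 0) = ρ4 := by
          rw [hρ4]
          by_cases h4 : netExp b s ≤ -4
          · rw [if_pos (by push_cast; omega), if_pos h4]
          · rw [if_neg (by push_cast; omega), if_neg h4]
        rw [e4, hEs, show (3 : ℕ) - 1 = 2 from rfl, show ((3 : ℕ) : ℤ) + E = E + 3 by ring] at h
        rw [show -(E + 5) = -(E + 3 + 2) by ring]
        exact h
      -- norms of the pieces
      have hρ3n : padicNorm p ρ3 ≤ 1 := padicNorm_classRho_le_one b h0 hsn hn hp2 3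
      have hρ4n : padicNorm p ρ4 ≤ 1 := by
        rw [hρ4]; split_ifs
        · exact padicNorm_classRho_le_one b h0 hsn hn hp2 4
        · simp
      have hgs1 : padicNorm p gs ≤ 1 := (padicNorm_gHat_class b hb hp5 hx hs hxmem).1
      have hgg : padicNorm p (gs - g) ≤ (p : ℚ) ^ (-(1 : ℤ)) := (padicNorm_gHat_class b hb hp5 hx hs hxmem).2
      have hφφ : padicNorm p (φs - φ) ≤ (p : ℚ) ^ (-(1 : ℤ)) := padicNorm_phiHat_sub_le b hp2 hs
      have hg2 : padicNorm p (gs - g * (1 - ℓ * p * φ)) ≤ (p : ℚ) ^ (-(2 : ℤ)) :=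
        padicNorm_gHat_sub_second_le b hp2 hx hs
      have hgφ : padicNorm p (gs * φs - g * φ) ≤ (p : ℚ) ^ (-(1 : ℤ)) := padicNorm_mul_sub_mul_le hgs1 hφ1 hgg hφφ
      -- the algebra
      have e : T s = (pfData b 2 s - (-(p : ℚ)) ^ (E + 3) * gs * (ρ3 - (p : ℚ) * φs * ρ4))
          + (-(p : ℚ)) ^ (E + 3) * ((gs - g * (1 - ℓ * p * φ)) * ρ3 - (p : ℚ) * ρ4 * (gs * φs - g * φ)) := by
        rw [hTs]; ring
      rw [e]
      refine (padicNorm.nonarchimedean (p := p)).trans (max_le hB ?_)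
      rw [padicNorm.mul, hpow]
      have hin : padicNorm p ((gs - g * (1 - ℓ * p * φ)) * ρ3 - (p : ℚ) * ρ4 * (gs * φs - g * φ)) ≤ (p : ℚ) ^ (-(2 : ℤ)) := by
        refine (padicNorm.sub (p := p)).trans (max_le ?_ ?_)
        · rw [padicNorm.mul]
          calc _ ≤ (p : ℚ) ^ (-(2 : ℤ)) * 1 := mul_le_mul hg2 hρ3n (padicNorm.nonneg _) (zpow_p_nonneg _)
            _ = _ := mul_one _
        · rw [padicNorm.mul, padicNorm.mul, padicNorm_p]
          calc (p : ℚ) ^ (-(1 : ℤ)) * padicNorm p ρ4 * padicNorm p (gs * φs - g * φ)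
              ≤ (p : ℚ) ^ (-(1 : ℤ)) * 1 * (p : ℚ) ^ (-(1 : ℤ)) :=
                mul_le_mul (mul_le_mul_of_nonneg_left hρ4n (zpow_p_nonneg _)) hgφ (padicNorm.nonneg _)
                  (mul_nonneg (zpow_p_nonneg _) zero_le_one)
            _ = (p : ℚ) ^ (-(2 : ℤ)) := by rw [mul_one, ← zpow_add₀ hp0]; norm_num
      calc (p : ℚ) ^ (-(E + 3)) * _ ≤ (p : ℚ) ^ (-(E + 3)) * (p : ℚ) ^ (-(2 : ℤ)) :=
            mul_le_mul_of_nonneg_left hin (zpow_p_nonneg _)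
        _ = (p : ℚ) ^ (-(E + 5)) := by rw [← zpow_add₀ hp0]; ring_nf
    · -- no pole of order ≥ 3 at `s`: the term vanishes
      have hTs : T s = 0 := by
        simp only [hT, if_neg h3, if_neg (show ¬ netExp b s ≤ -4 by omega)]
        rw [pfData_eq_zero_of_order_le b hb hsn (by norm_num) (by push_cast; omega)]
        ring
      rw [hTs, padicNorm.zero]; exact zpow_p_nonneg _
  apply val_ge_of_padicNorm_le hne
  rw [hsplit]
  exact padicNorm.sum_le' hterm (zpow_p_nonneg _)

end Summit.KontsevichZagierPeriods.Zeta5Search.SecondOrder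

end
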